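import Literature.AlgebraicGeometry.Motives.HodgeThetaSubalgebraUnitaryEightNineCore
import Literature.AlgebraicGeometry.Motives.HodgeThetaSubalgebraUnitaryEightCore
import Literature.AlgebraicGeometry.Motives.HodgeThetaSubalgebraUnitaryFourOddCore
import Literature.AlgebraicGeometry.Motives.HodgeThetaSubalgebraUnitaryRaisingRankTriple
import Literature.AlgebraicGeometry.Motives.HodgeThetaSubalgebraUnitaryRankOneRaiseTwo
import HarnessLib

/-!
# The `Θ`-subalgebra theorem for unitary multiplicities `(8, 21)` — the first CONSTANT-RANK stall, closed
# classification-free by the inner double Levi (Ribet 1983 Thm. 3, Lie step; abelian 29-folds of type `(8, 21)`)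

Family `hodge`, layer `Literature/AlgebraicGeometry/Motives` (pure linear algebra over `ℂ`; no geometry). Research
context: cell `pub-hodge-ring2` (HONEST FRAMING: research route conditional on HC_CM; not a corollary; Q11.4-sentence-2
already refuted in dim ≥ 3), Literature lane gen 85, programme R72. UNCONDITIONAL; theorems only, no definition, no
named fact (D-0026), no `sorry`.

THE PRINT. K. A. Ribet, Amer. J. Math. 105 (1983), Thm. 3 = Gordon's survey Thm. 6.3 (3) [held
`paper:arxiv-alg-geom_9709030` p. 18]: `End⁰ = k` imaginary quadratic acting with coprime multiplicities `(n′, n″)` ⟹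
`Hg = U(V, φ)`, `B•(Xⁿ) = D•(Xⁿ)`. The lane replaces Ribet's appeal to the classification of minuscule representations
pair by pair; after R70/R71 every remaining prime cell `≤ 31` was an «`r = 6` stall» (lit-g85 README §HEIRS), and at
`(8, 21)` the pencil lemma even forces every non-zero raising operator to have rank EXACTLY `6`.

THE ARGUMENT (`UnitaryEightTwentyOne.eq_top_of_smul`). Ranks `1, 2, 4, 5, 8` are «good» (larger-side Levi types
`(1|20)`, `(2|19)`, `(4|17)`, `(5|16)`, `(8|13)` are tree cores — `UnitaryDoubleLevi.eq_top_of_raise_of_core`); rank `7`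
yields rank `8` (`UnitaryRaisingRank.exists_raise_rank_gt_of_finrank_eq_succ_of_smul`, `14(8 − ρ) ≠ 7ρ`); rank `3` is
excluded by the pencil lemma with the `(5|3)` core exactly as at `(8, 9)`. So if `𝔊 ≠ End(W)`, every non-zero raising
operator has rank `6`. Fix one, `B`, with involution `ι` (`U⁺ = (P ∩ ker C) ⊕ C(P)` of type `(2 | 6)`,
`U⁻ = B(W) ⊕ (Q ∩ ker B)` of type `(6 | 15)`). By `UnitaryLeviFull.exists_raise_commute_apply_ne_zero` some raising
`X ∈ 𝔊` commuting with `ι` is non-zero on `C(P)`; `rk X = rk X|_{U⁺} + rk X|_{U⁻} = 6` (§1) with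
`1 ≤ rk X|_{U⁺} ≤ dim (P ∩ ker C) = 2`.
* `rk X|_{U⁺} = 1`: `X|_{U⁺}` is a rank-one raising element of the concrete Levi algebra `L⁺` (type `(2 | 6)`,
  axioms by `UnitaryLeviFull.levi_axioms`), so `L⁺` is full by `UnitaryRankOneRaise.eq_top_of_rankOne_raise_two`; then
  the maximality polarisation `UnitaryLeviFull.exists_rankOne_raise_of_maxRank` (`B` has maximal rank, `P ∩ ker C` has
  two independent vectors) produces a rank-one raising operator in `𝔊` — rank `1 ≠ 6`.
* `rk X|_{U⁺} = 2`: `X|_{U⁻}` is a rank-`4` raising element of the concrete Levi algebra `L⁻` (type `(6 | 15)`), whose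
  own larger-side Levi type `(4 | 11)` IS a core (`UnitaryFourOdd.eq_top`): `UnitaryDoubleLevi.eq_top_of_raise_of_core`
  applied INSIDE `L⁻` makes `L⁻` full, and `UnitaryLeviFull.exists_rankOne_raise_of_full` produces a rank-one raising
  operator in `𝔊` — again impossible.
**`UnitaryEightTwentyOne.eq_top_of_smul'`** is the mirror `(21, 8)`. (`ℂ`-homogeneity of `s` is used only through the
`(5|16)`, `(8|13)` cores and the rank-`7` step.) §3 **`UnitaryEight.eq_top_of_smul_twentynine`**: at `(8, 29)` EVERY
raising rank now has a larger-side core (`(8|21)` being the last), so `(8 | 29)` follows from one raising operator.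

CONSEQUENCE (sequel `HodgeTheory/RibetTypeEightTwentyOnePowersHodgeClasses`): Ribet's theorem at `(n′, n″) = (8, 21)`
and `(8, 29)`; the `p = 29` census cell `{8, 21}` and the `p = 37` cell `{8, 29}`.

## References
* [Ribet1983] K. A. Ribet, *Hodge classes on certain types of abelian varieties*, Amer. J. Math. 105 (1983), Thm. 3.
* [Gordon1997] B. B. Gordon, *A survey of the Hodge conjecture for abelian varieties*, Thm. 6.3 (3), pp. 18–19.
* [Deligne1982HodgeCycles] P. Deligne, *Hodge cycles on abelian varieties*, LNM 900 (1982), I §3 Prop. 3.4, 3.6.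
* [GoodmanWallachGTM255] R. Goodman, N. R. Wallach, GTM 255 (2009), §4.1.1.
* [Humphreys1972] J. E. Humphreys, *Introduction to Lie Algebras and Representation Theory*, §19.1.
* [HoffmanKunze1971LinearAlgebra] K. Hoffman, R. Kunze, *Linear Algebra* (1971), §3.1 Thm. 2, §6.7.
-/

noncomputable section

open Module

namespace Literature.AlgebraicGeometry.Motives

namespace HodgeStructure

universe u

variable {W : Type u} [AddCommGroup W] [Module ℂ W]

/-! ### §1 Rank bookkeeping for operators commuting with an involution -/

/-- For `X` commuting with an involution `ι`, `rk X = rk X|_{U⁺} + rk X|_{U⁻}` (`U^± = {ι = ±1}`).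
[cite: HoffmanKunze1971LinearAlgebra, §3.1 Thm. 2, §6.7] -/
theorem UnitaryLeviRank.finrank_range_eq_add [FiniteDimensional ℂ W] {ι X : Module.End ℂ W} (hιι : ι * ι = 1)
    {Um Up : Submodule ℂ W} (hUm : ∀ x, x ∈ Um ↔ ι x = -x) (hUp : ∀ x, x ∈ Up ↔ ι x = x) (hXc : X * ι = ι * X) :
    Module.finrank ℂ (LinearMap.range X) = Module.finrank ℂ (Up.map X) + Module.finrank ℂ (Um.map X) := by
  have hιv : ∀ v, ι (ι v) = v := fun v => by rw [← Module.End.mul_apply, hιι, Module.End.one_apply]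
  have hsup : Up ⊔ Um = ⊤ := by
    rw [eq_top_iff]
    intro w _
    have hp : (2 : ℂ)⁻¹ • (w + ι w) ∈ Up := (hUp _).2 (by rw [map_smul, map_add, hιv, add_comm])
    have hm : (2 : ℂ)⁻¹ • (w - ι w) ∈ Um := (hUm _).2 (by rw [map_smul, map_sub, hιv, ← smul_neg, neg_sub])
    have hw : w = (2 : ℂ)⁻¹ • (w + ι w) + (2 : ℂ)⁻¹ • (w - ι w) := by module
    rw [hw]
    exact Submodule.add_mem _ (Submodule.mem_sup_left hp) (Submodule.mem_sup_right hm)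
  have hinf : Up.map X ⊓ Um.map X = ⊥ := by
    rw [Submodule.eq_bot_iff]
    intro x hx
    obtain ⟨h1, h2⟩ := Submodule.mem_inf.1 hx
    obtain ⟨p, hp, rfl⟩ := Submodule.mem_map.1 h1
    obtain ⟨m, hm, hmp⟩ := Submodule.mem_map.1 h2
    have e1 : ι (X p) = X p := by rw [← Module.End.mul_apply, ← hXc, Module.End.mul_apply, (hUp p).1 hp]
    have e2 : ι (X p) = -(X p) := by
      rw [← hmp, ← Module.End.mul_apply, ← hXc, Module.End.mul_apply, (hUm m).1 hm, map_neg]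
    rw [e1] at e2
    have : (2 : ℂ) • X p = 0 := by rw [two_smul]; nth_rewrite 2 [e2]; rw [add_neg_cancel]
    exact (smul_eq_zero.1 this).resolve_left two_ne_zero
  have h := Submodule.finrank_sup_add_finrank_inf_eq (Up.map X) (Um.map X)
  rw [hinf, finrank_bot, add_zero, ← Submodule.map_sup, hsup, ← LinearMap.range_eq_map] at h
  exact h

/-- The rank of a restricted operator: `rk (X|_U) = dim X(U)`. [cite: HoffmanKunze1971LinearAlgebra, §3.1 Thm. 2] -/
theorem UnitaryLeviRank.finrank_range_restrict [FiniteDimensional ℂ W] {X : Module.End ℂ W} {U : Submodule ℂ W}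
    (hX : ∀ x ∈ U, X x ∈ U) :
    Module.finrank ℂ (LinearMap.range (X.restrict hX)) = Module.finrank ℂ (U.map X) := by
  have hle : U.map X ≤ U := by
    rintro _ ⟨x, hx, rfl⟩; exact hX x hx
  have heq : LinearMap.range (X.restrict hX) = (U.map X).comap U.subtype := by
    ext y
    rw [LinearMap.mem_range, Submodule.mem_comap, Submodule.subtype_apply, Submodule.mem_map]
    constructor
    · rintro ⟨x, rfl⟩
      exact ⟨x, x.2, rfl⟩
    · rintro ⟨x, hx, hxy⟩
      exact ⟨⟨x, hx⟩, Subtype.ext (by rw [LinearMap.restrict_apply]; exact hxy)⟩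
  rw [heq, (Submodule.comapSubtypeEquivOfLe hle).finrank_eq]

/-! ### §2 The `(8 | 21)` core -/

/-- **THE `Θ`-SUBALGEBRA THEOREM FOR UNITARY MULTIPLICITIES `(8, 21)` — complex Hermitian core, classification-free.**
`𝔊 ⊆ End(W)` bracket-closed and irreducible, `Θ ∈ 𝔊` an involution with `dim P = 8`, `dim Q = 21`, Hermitian data
(`s` additive and `ℂ`-homogeneous in the first slot, Hermitian-symmetric, `P ⊥ Q`, definite on `P` and on `Q`), `𝔊`
adjoint-closed ⟹ `𝔊 = End(W)`. See the module docstring. [cite: Ribet1983, Thm. 3] [cite: Gordon1997, Thm. 6.3 (3)]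
[cite: Deligne1982HodgeCycles, I §3 Prop. 3.4, 3.6] [cite: GoodmanWallachGTM255, §4.1.1] -/
theorem UnitaryEightTwentyOne.eq_top_of_smul [FiniteDimensional ℂ W] {𝔊 : Submodule ℂ (Module.End ℂ W)}
    (hbr : ∀ Y ∈ 𝔊, ∀ Z ∈ 𝔊, Y * Z - Z * Y ∈ 𝔊)
    (hirr : ∀ U : Submodule ℂ W, (∀ A ∈ 𝔊, ∀ u ∈ U, A u ∈ U) → U = ⊥ ∨ U = ⊤)
    {Θ : Module.End ℂ W} (hΘ : Θ ∈ 𝔊) (hΘΘ : Θ * Θ = 1)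
    {P Q : Submodule ℂ W} (hP : ∀ x, x ∈ P ↔ Θ x = x) (hQ : ∀ x, x ∈ Q ↔ Θ x = -x)
    (hP8 : Module.finrank ℂ P = 8) (hQ21 : Module.finrank ℂ Q = 21)
    {s : W → W → ℂ} (hadd : ∀ x y z, s (x + y) z = s x z + s y z)
    (hsmul : ∀ (c : ℂ) (x y : W), s (c • x) y = c * s x y) (hsymm : ∀ x y, s y x = starRingEnd ℂ (s x y))
    (hPQ : ∀ p ∈ P, ∀ q ∈ Q, s p q = 0) (hdefP : ∀ p ∈ P, s p p = 0 → p = 0) (hdefQ : ∀ q ∈ Q, s q q = 0 → q = 0)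
    (hadj : ∀ X ∈ 𝔊, ∃ Y ∈ 𝔊, ∀ x y, s (X x) y = s x (Y y)) : 𝔊 = ⊤ := by
  classical
  obtain ⟨haddr, h0r, h0l, hnegr, hnegl, hsubr, hsubl⟩ := UnitaryTwoOdd.herm_right hadd hsymm
  have hΘΘv : ∀ v, Θ (Θ v) = v := fun v => by rw [← Module.End.mul_apply, hΘΘ, Module.End.one_apply]
  have hraiseval : ∀ Z : Module.End ℂ W, Θ * Z = Z → ∀ w, Z w ∈ P := fun Z hΘZ w =>
    (hP _).2 (by rw [← Module.End.mul_apply, hΘZ])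
  have hle8 : ∀ B' : Module.End ℂ W, Θ * B' = B' → Module.finrank ℂ (LinearMap.range B') ≤ 8 := fun B' h => by
    rw [← hP8]
    exact Submodule.finrank_mono (by rintro _ ⟨w, rfl⟩; exact hraiseval B' h w)
  -- the Hermitian data restricted to a subspace
  have hsU : ∀ U : Submodule ℂ W, ∀ x y z : U, s ((x + y : U) : W) z = s (x : W) z + s (y : W) z :=
    fun U x y z => by simp only [Submodule.coe_add, hadd]
  have hsmU : ∀ U : Submodule ℂ W, ∀ (c : ℂ) (x y : U), s ((c • x : U) : W) y = c * s (x : W) y :=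
    fun U c x y => by simp only [Submodule.coe_smul, hsmul]
  -- STEP 1: the good ranks `1, 2, 4, 5, 8`
  have key : ∀ B' ∈ 𝔊, Θ * B' = B' → B' * Θ = -B' →
      (Module.finrank ℂ (LinearMap.range B') = 1 ∨ Module.finrank ℂ (LinearMap.range B') = 2 ∨
        Module.finrank ℂ (LinearMap.range B') = 4 ∨ Module.finrank ℂ (LinearMap.range B') = 5 ∨
        Module.finrank ℂ (LinearMap.range B') = 8) → 𝔊 = ⊤ := by
    intro B' hB' hΘB' hB'Θ hr
    refine UnitaryDoubleLevi.eq_top_of_raise_of_core hbr hirr hΘ hΘΘ hP hQ hadd hsymm hPQ hdefP hdefQ hadj hB' hΘB' hB'Θ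
      (by omega) (by omega) (by omega)
      fun U 𝔩 ι P' Q' hbr𝔩 hirr𝔩 hι hιι hP' hQ' hfinP' hfinQ' hP'Q' hdefP' hdefQ' hadj𝔩 => ?_
    rw [hQ21] at hfinQ'
    rcases hr with h | h | h | h | h <;> rw [h] at hfinP' hfinQ'
    · -- `(1 | 20)`: the `(m, 1)` core for `−ι`
      exact UnitaryThreeCoprime.eq_top_of_finrank_eq_one hbr𝔩 hirr𝔩 (Submodule.neg_mem _ hι)
        ((neg_mul_neg ι ι).trans hιι) (P := Q') (Q := P') (fun x => by rw [hQ', LinearMap.neg_apply, neg_eq_iff_eq_neg])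
        (fun x => by rw [hP', LinearMap.neg_apply, neg_inj]) (by omega) hfinP'
    · -- `(2 | 19)`
      exact UnitaryTwoOdd.eq_top hbr𝔩 hirr𝔩 hι hιι hP' hQ' hfinP' ⟨9, by omega⟩ (s := fun x y : U => s (x : W) y)
        (hsU U) (fun x y => hsymm x y) hP'Q' hdefP' hdefQ' hadj𝔩
    · -- `(4 | 17)`
      exact UnitaryFourOdd.eq_top hbr𝔩 hirr𝔩 hι hιι hP' hQ' hfinP' ⟨8, by omega⟩ (s := fun x y : U => s (x : W) y)
        (hsU U) (fun x y => hsymm x y) hP'Q' hdefP' hdefQ' hadj𝔩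
    · -- `(5 | 16)`
      exact UnitaryFive.eq_top_of_smul hbr𝔩 hirr𝔩 hι hιι hP' hQ' hfinP' (by omega) (s := fun x y : U => s (x : W) y)
        (hsU U) (hsmU U) (fun x y => hsymm x y) hP'Q' hdefP' hdefQ' hadj𝔩
    · -- `(8 | 13)`
      exact UnitaryEight.eq_top_of_smul hbr𝔩 hirr𝔩 hι hιι hP' hQ' hfinP' ⟨6, by omega⟩ (by omega) (by omega)
        (s := fun x y : U => s (x : W) y) (hsU U) (hsmU U) (fun x y => hsymm x y) hP'Q' hdefP' hdefQ' hadj𝔩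
  -- STEP 2: otherwise every raising operator has rank in `{0, 3, 6}` (rank `7` would give rank `8`)
  by_contra hne
  have hbad7 : ∀ B' ∈ 𝔊, Θ * B' = B' → B' * Θ = -B' →
      Module.finrank ℂ (LinearMap.range B') = 0 ∨ Module.finrank ℂ (LinearMap.range B') = 3 ∨
        Module.finrank ℂ (LinearMap.range B') = 6 ∨ Module.finrank ℂ (LinearMap.range B') = 7 := by
    intro B' hB' hΘB' hB'Θ
    have h8 := hle8 B' hΘB'
    have hk : ¬ (Module.finrank ℂ (LinearMap.range B') = 1 ∨ Module.finrank ℂ (LinearMap.range B') = 2 ∨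
        Module.finrank ℂ (LinearMap.range B') = 4 ∨ Module.finrank ℂ (LinearMap.range B') = 5 ∨
        Module.finrank ℂ (LinearMap.range B') = 8) :=
      fun h => hne (key B' hB' hΘB' hB'Θ h)
    omega
  have hbad : ∀ B' ∈ 𝔊, Θ * B' = B' → B' * Θ = -B' →
      Module.finrank ℂ (LinearMap.range B') = 0 ∨ Module.finrank ℂ (LinearMap.range B') = 3 ∨
        Module.finrank ℂ (LinearMap.range B') = 6 := by
    intro B' hB' hΘB' hB'Θ
    rcases hbad7 B' hB' hΘB' hB'Θ with h | h | h | h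
    · exact Or.inl h
    · exact Or.inr (Or.inl h)
    · exact Or.inr (Or.inr h)
    · -- rank `7`: the triple route gives a raising operator of rank `8`
      exfalso
      obtain ⟨B'', hB'', hΘB'', hB''Θ, hgt⟩ :=
        UnitaryRaisingRank.exists_raise_rank_gt_of_finrank_eq_succ_of_smul hbr hirr hΘ hΘΘ hP hQ hB' hΘB' hB'Θ
          (by omega) (by omega) (by omega) (fun ρ h1 h2 => by rw [h] at h2; rw [h, hQ21]; omega) hadd hsmul hsymm hPQ hdefP
          hdefQ hadj
      have h8 := hle8 B'' hΘB''
      rcases hbad7 B'' hB'' hΘB'' hB''Θ with h' | h' | h' | h' <;> omega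
  obtain ⟨B₂, hB₂, hΘB₂, hB₂Θ, hr2⟩ :=
    UnitaryThreeCoprime.exists_raise_rank_ge_two hbr hirr hΘ hΘΘ hP hQ (by omega) (by omega)
  by_cases h3 : ∃ A ∈ 𝔊, Θ * A = A ∧ A * Θ = -A ∧ Module.finrank ℂ (LinearMap.range A) = 3
  · -- STEP 3: a rank-three raising operator is impossible (pencil through the `(5 | 3)` core)
    obtain ⟨A, hA, hΘA, hAΘ, hA3⟩ := h3
    obtain ⟨B₁, hB₁, B₂', hB₂', hΘB₁, hB₁Θ, hΘB₂', hB₂'Θ, m₀, m₁, m₂, m₃, hm₀, hm₁, hm₂, hm₃, hr₀, hr₁, hr₂, hr₃, himp⟩ :=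
      UnitaryPencil.exists_pencil_of_core hbr hirr hΘ hΘΘ hP hQ hadd hsymm hPQ hdefP hdefQ hadj hA hΘA hAΘ (by omega)
        (by omega)
        fun U 𝔩 ι P' Q' hbr𝔩 hirr𝔩 hι hιι hP' hQ' hfinP' hfinQ' hP'Q' hdefP' hdefQ' hadj𝔩 => by
          rw [hA3, hP8] at hfinP'
          rw [hA3] at hfinQ'
          exact UnitaryThreeCoprime.eq_top' hbr𝔩 hirr𝔩 hι hιι hP' hQ' (by omega) hfinQ'
            (s := fun x y : U => s (x : W) y) (hsU U) (fun x y => hsymm x y) hP'Q' hdefP' hdefQ' hadj𝔩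
    rw [hA3] at hm₀ hm₁ hm₂ hm₃
    have e₀ := hbad B₁ hB₁ hΘB₁ hB₁Θ
    have e₁ := hbad (B₁ + B₂') (Submodule.add_mem _ hB₁ hB₂') (by rw [mul_add, hΘB₁, hΘB₂'])
      (by rw [add_mul, hB₁Θ, hB₂'Θ, neg_add])
    have e₂ := hbad (B₁ - B₂') (Submodule.sub_mem _ hB₁ hB₂') (by rw [mul_sub, hΘB₁, hΘB₂'])
      (by rw [sub_mul, hB₁Θ, hB₂'Θ, neg_sub_neg, neg_sub])
    have e₃ := hbad (B₁ + (2 : ℂ) • B₂') (Submodule.add_mem _ hB₁ (Submodule.smul_mem _ _ hB₂'))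
      (by rw [mul_add, mul_smul_comm, hΘB₁, hΘB₂']) (by rw [add_mul, smul_mul_assoc, hB₁Θ, hB₂'Θ, smul_neg, neg_add])
    rw [hr₀] at e₀; rw [hr₁] at e₁; rw [hr₂] at e₂; rw [hr₃] at e₃
    have := himp (by omega) (by omega) (by omega)
    omega
  -- STEP 4: every non-zero raising operator has rank exactly `6`; fix one, `B`, with its involution `ι`
  have hsix : ∀ B' ∈ 𝔊, Θ * B' = B' → B' * Θ = -B' → B' ≠ 0 → Module.finrank ℂ (LinearMap.range B') = 6 := by
    intro B' hB' hΘB' hB'Θ hB'ne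
    have hpos : 0 < Module.finrank ℂ (LinearMap.range B') := by
      rw [Module.finrank_pos_iff_exists_ne_zero]
      by_contra h0
      push Not at h0
      apply hB'ne
      refine LinearMap.ext fun w => ?_
      have := h0 ⟨B' w, LinearMap.mem_range_self B' w⟩
      rw [LinearMap.zero_apply]
      exact congrArg Subtype.val this
    rcases hbad B' hB' hΘB' hB'Θ with h | h | h
    · omega
    · exact absurd ⟨B', hB', hΘB', hB'Θ, h⟩ h3
    · exact h
  have hno1 : ∀ B' ∈ 𝔊, Θ * B' = B' → B' * Θ = -B' → Module.finrank ℂ (LinearMap.range B') ≠ 1 := by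
    intro B' hB' hΘB' hB'Θ h1
    rcases hbad B' hB' hΘB' hB'Θ with h | h | h <;> omega
  set B := B₂ with hBdef
  have hB : B ∈ 𝔊 := hB₂
  have hΘB : Θ * B = B := hΘB₂
  have hBΘ : B * Θ = -B := hB₂Θ
  have h6 : Module.finrank ℂ (LinearMap.range B) = 6 := by
    rcases hbad B hB hΘB hBΘ with h | h | h
    · omega
    · exact absurd ⟨B, hB, hΘB, hBΘ, h⟩ h3
    · exact h
  have hmax : ∀ B' ∈ 𝔊, Θ * B' = B' → B' * Θ = -B' →
      Module.finrank ℂ (LinearMap.range B') ≤ Module.finrank ℂ (LinearMap.range B) := by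
    intro B' hB' hΘB' hB'Θ
    rcases hbad B' hB' hΘB' hB'Θ with h | h | h <;> omega
  obtain ⟨C, hC, ι, hιmem, hBC, hΘC, hCΘ, hιι, hιΘ, hιs, hιa, hιd, hιb, hιc, hmemA, hmemD, hmemB, hmemC, hfinP₀, hfinQ₀,
    hfinQU, hrangeP, hmapCQ, hfinUm, hfinUp⟩ :=
    UnitaryLeviKernel.exists_involution hbr hΘ hΘΘ hP hQ hadd hsymm hPQ hdefP hdefQ hadj hB hΘB hBΘ
  have hιv : ∀ v, ι (ι v) = v := fun v => by rw [← Module.End.mul_apply, hιι, Module.End.one_apply]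
  have hιΘv : ∀ w, ι (Θ w) = Θ (ι w) := fun w => by rw [← Module.End.mul_apply, hιΘ, Module.End.mul_apply]
  rw [h6, hP8] at hfinP₀
  rw [h6, hQ21] at hfinQ₀
  rw [h6] at hfinQU
  have hP₀2 : Module.finrank ℂ ↥(P ⊓ LinearMap.ker C) = 2 := by omega
  have hQ₀15 : Module.finrank ℂ ↥(Q ⊓ LinearMap.ker B) = 15 := by omega
  rw [hQ21] at hfinUm
  rw [hP8] at hfinUp
  set Um : Submodule ℂ W := LinearMap.ker (ι + 1) with hUmdef
  set Up : Submodule ℂ W := LinearMap.ker (ι - 1) with hUpdef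
  have hUm : ∀ x, x ∈ Um ↔ ι x = -x := fun x => by
    rw [hUmdef, LinearMap.mem_ker, LinearMap.add_apply, Module.End.one_apply, add_eq_zero_iff_eq_neg]
  have hUp : ∀ x, x ∈ Up ↔ ι x = x := fun x => by
    rw [hUpdef, LinearMap.mem_ker, LinearMap.sub_apply, Module.End.one_apply, sub_eq_zero]
  have hcm : ∀ Z : Module.End ℂ W, Z * ι = ι * Z → ∀ x ∈ Um, Z x ∈ Um := fun Z hZ x hx =>
    (hUm _).2 (by rw [← Module.End.mul_apply, ← hZ, Module.End.mul_apply, (hUm x).1 hx, map_neg])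
  have hcp : ∀ Z : Module.End ℂ W, Z * ι = ι * Z → ∀ x ∈ Up, Z x ∈ Up := fun Z hZ x hx =>
    (hUp _).2 (by rw [← Module.End.mul_apply, ← hZ, Module.End.mul_apply, (hUp x).1 hx])
  have hraiseP : ∀ Y : Module.End ℂ W, Y * Θ = -Y → ∀ p, Θ p = p → Y p = 0 := fun Y hYΘ p hp => by
    have h : Y p = -(Y p) := by
      conv_lhs => rw [← hp]
      rw [← Module.End.mul_apply, hYΘ, LinearMap.neg_apply]
    have h2 : (2 : ℂ) • Y p = 0 := by rw [two_smul]; nth_rewrite 2 [h]; rw [add_neg_cancel]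
    exact (smul_eq_zero.1 h2).resolve_left two_ne_zero
  -- the Levi algebras `L^∓` of `ι`
  obtain ⟨Im, Ip, Lm, Lp, -, -, hLm, hLp, -⟩ := UnitaryLeviKernel.exists_kernel_levi 𝔊 hιι hUm hUp
  -- STEP 5: a raising `X` commuting with `ι`, non-zero on `C(P)`; `rk X = rk X|_{U⁺} + rk X|_{U⁻} = 6`
  have hp0 : ∃ p, p ≠ 0 ∧ ι p = p ∧ Θ p = p := by
    obtain ⟨⟨p, hp⟩, hp0⟩ := Module.finrank_pos_iff_exists_ne_zero.1
      (show 0 < Module.finrank ℂ ↥(P ⊓ LinearMap.ker C) by omega)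
    exact ⟨p, fun h => hp0 (Subtype.ext h), hιb p hp, (hP p).1 (Submodule.mem_inf.1 hp).1⟩
  have hq0 : ∃ q, q ≠ 0 ∧ ι q = q ∧ Θ q = -q := by
    obtain ⟨⟨q, hq⟩, hq0⟩ := Module.finrank_pos_iff_exists_ne_zero.1
      (show 0 < Module.finrank ℂ ↥(P.map C) by omega)
    exact ⟨q, fun h => hq0 (Subtype.ext h), hιc q hq, (hQ q).1 (hmapCQ hq)⟩
  obtain ⟨X, hX, hΘX, hXΘ, hXc, c, hιc', hΘc, hXc0⟩ :=
    UnitaryLeviFull.exists_raise_commute_apply_ne_zero hbr hirr hΘ hΘΘ hQ hιmem hιι hιΘ hUm hUp hp0 hq0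
  have hXne : X ≠ 0 := fun h => hXc0 (by rw [h, LinearMap.zero_apply])
  have hX6 := hsix X hX hΘX hXΘ hXne
  have hXsplit := UnitaryLeviRank.finrank_range_eq_add hιι hUm hUp hXc
  rw [hX6] at hXsplit
  have hXUp_le : Up.map X ≤ P ⊓ LinearMap.ker C := by
    rintro _ ⟨x, hx, rfl⟩
    exact hmemB _ ((hUp _).1 (hcp X hXc x hx)) (by rw [← Module.End.mul_apply, hΘX])
  have hXUp2 : Module.finrank ℂ (Up.map X) ≤ 2 := (Submodule.finrank_mono hXUp_le).trans (by omega)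
  have hcUp : c ∈ Up := (hUp c).2 hιc'
  have hXUp1 : 1 ≤ Module.finrank ℂ (Up.map X) := by
    rw [Nat.one_le_iff_ne_zero, Ne, Submodule.finrank_eq_zero]
    intro h0
    have : X c ∈ Up.map X := Submodule.mem_map_of_mem hcUp
    rw [h0, Submodule.mem_bot] at this
    exact hXc0 this
  have hc0 : c ≠ 0 := fun h => hXc0 (by rw [h, map_zero])
  -- the two cases
  rcases Nat.eq_or_lt_of_le hXUp2 with hXUp | hXUp
  · -- CASE `rk X|_{U⁺} = 2`, `rk X|_{U⁻} = 4`: the inner double Levi in `L⁻` with the `(4 | 11)` core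
    have hXUm : Module.finrank ℂ (Um.map X) = 4 := by omega
    -- the concrete Levi algebra `L⁻` satisfies the axioms
    have hPUle : LinearMap.range B ≤ Um := fun x hx => (hUm x).2 (hιa x hx)
    have hQUle : Q ⊓ LinearMap.ker B ≤ Um := fun d hd => (hUm d).2 (hιd d hd)
    have hPUmem : ∀ x ∈ Um, Θ x = x → x ∈ LinearMap.range B := fun x hx hΘx => hmemA x ((hUm x).1 hx) hΘx
    have hPUΘ : ∀ x ∈ LinearMap.range B, Θ x = x := fun x hx => (hP x).1 (hrangeP hx)
    have hQUmem : ∀ x ∈ Um, Θ x = -x → x ∈ Q ⊓ LinearMap.ker B := fun x hx hΘx => hmemD x ((hUm x).1 hx) hΘx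
    have hQUΘ : ∀ x ∈ Q ⊓ LinearMap.ker B, Θ x = -x := fun x hx => (hQ x).1 (Submodule.mem_inf.1 hx).1
    have hPUQU : ∀ x ∈ LinearMap.range B, ∀ y ∈ Q ⊓ LinearMap.ker B, s x y = 0 := fun x hx y hy =>
      hPQ x (hrangeP hx) y (Submodule.mem_inf.1 hy).1
    have hdefPU : ∀ x ∈ LinearMap.range B, s x x = 0 → x = 0 := fun x hx h => hdefP x (hrangeP hx) h
    have hdefQU : ∀ y ∈ Q ⊓ LinearMap.ker B, s y y = 0 → y = 0 := fun y hy h =>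
      hdefQ y (Submodule.mem_inf.1 hy).1 h
    obtain ⟨ιm, Pm, Qm, hιmapply, hPmmem, hQmmem, hbrLm, hirrLm, hιmmem, hιmιm, hPm, hQm, hfinPm, hfinQm, hPmQm, hdefPm,
      hdefQm, hadjLm, -, -⟩ :=
      UnitaryLeviFull.levi_axioms hbr hirr hΘΘ hP hQ hadd hsymm hPQ hdefP hdefQ hadj hιmem hιι hιs hΘ hΘΘ hιΘ hUm hPUle
        hQUle hPUmem hPUΘ hQUmem hQUΘ hPUQU hdefPU hdefQU hLm
    rw [h6] at hfinPm
    rw [hQ₀15] at hfinQm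
    -- the restriction `x = X|_{U⁻}`: a rank-`4` raising element of `L⁻`
    set x : Module.End ℂ Um := X.restrict (hcm X hXc) with hxdef
    have hxval : ∀ v : Um, ((x v : Um) : W) = X v := fun v => rfl
    have hxmem : x ∈ Lm := (hLm x).2 ⟨X, hX, hXc, hxval⟩
    have hιmx : ιm * x = x := LinearMap.ext fun v => Subtype.ext (by
      rw [Module.End.mul_apply, hιmapply, hxval, ← Module.End.mul_apply, hΘX])
    have hxιm : x * ιm = -x := LinearMap.ext fun v => Subtype.ext (by
      rw [Module.End.mul_apply, LinearMap.neg_apply, Submodule.coe_neg, hxval, hιmapply, ← Module.End.mul_apply, hXΘ,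
        LinearMap.neg_apply, hxval])
    have hxrk : Module.finrank ℂ (LinearMap.range x) = 4 := by
      rw [hxdef, UnitaryLeviRank.finrank_range_restrict, hXUm]
    have hLmtop : Lm = ⊤ := by
      refine UnitaryDoubleLevi.eq_top_of_raise_of_core hbrLm hirrLm hιmmem hιmιm hPm hQm (s := fun v w : Um => s (v : W) w)
        (hsU Um) (fun v w => hsymm v w) hPmQm hdefPm hdefQm hadjLm hxmem hιmx hxιm (by rw [hxrk]; norm_num)
        (by rw [hfinPm]; norm_num) (by rw [hfinPm, hfinQm]; norm_num)
        fun U' 𝔩' ι' P' Q' hbr𝔩' hirr𝔩' hι' hι'ι' hP' hQ' hfinP' hfinQ' hP'Q' hdefP' hdefQ' hadj𝔩' => ?_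
      rw [hxrk] at hfinP' hfinQ'
      rw [hfinQm] at hfinQ'
      exact UnitaryFourOdd.eq_top hbr𝔩' hirr𝔩' hι' hι'ι' hP' hQ' hfinP' ⟨5, by omega⟩
        (s := fun v w : U' => s ((v : Um) : W) w) (fun v w z => by simp only [Submodule.coe_add, hadd])
        (fun v w => hsymm _ _) hP'Q' hdefP' hdefQ' hadj𝔩'
    have hfullm : ∀ T : Module.End ℂ Um, ∃ Z ∈ 𝔊, Z * ι = ι * Z ∧ ∀ v : Um, ((T v : Um) : W) = Z v := fun T =>
      (hLm T).1 (by rw [hLmtop]; exact Submodule.mem_top)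
    -- a rank-one raising operator: contradiction
    obtain ⟨⟨u, hu⟩, hu0⟩ := Module.finrank_pos_iff_exists_ne_zero.1
      (show 0 < Module.finrank ℂ (LinearMap.range B) by omega)
    have hu0' : u ≠ 0 := fun h => hu0 (Subtype.ext h)
    obtain ⟨⟨q₀, hq₀⟩, hq₀0⟩ := Module.finrank_pos_iff_exists_ne_zero.1
      (show 0 < Module.finrank ℂ ↥(Q ⊓ LinearMap.ker B) by omega)
    have hq₀0' : q₀ ≠ 0 := fun h => hq₀0 (Subtype.ext h)
    obtain ⟨B₁, hB₁, hΘB₁, hB₁Θ, hr1⟩ := UnitaryLeviFull.exists_rankOne_raise_of_full hbr hΘΘ hιι hιΘ hUm hUp hfullm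
      (by omega) (by omega) (hPUΘ u hu) (hιa u hu) hu0' (hQUΘ q₀ hq₀) (hιd q₀ hq₀) hq₀0'
    exact hno1 B₁ hB₁ hΘB₁ hB₁Θ hr1
  · -- CASE `rk X|_{U⁺} = 1`: `X|_{U⁺}` is a rank-one raising element of `L⁺` (type `(2 | 6)`), so `L⁺` is full
    have hXUp' : Module.finrank ℂ (Up.map X) = 1 := by omega
    -- the concrete Levi algebra `L⁺` (involution `−ι`) satisfies the axioms
    have hnι : -ι ∈ 𝔊 := Submodule.neg_mem _ hιmem
    have hnιι : (-ι) * (-ι) = 1 := by rw [neg_mul_neg, hιι]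
    have hnιs : ∀ v w, s ((-ι) v) w = s v ((-ι) w) := fun v w => by
      rw [LinearMap.neg_apply, LinearMap.neg_apply, hnegl, hnegr, hιs]
    have hnιΘ : (-ι) * Θ = Θ * (-ι) := by rw [neg_mul, mul_neg, hιΘ]
    have hUp' : ∀ v, v ∈ Up ↔ (-ι) v = -v := fun v => by rw [hUp, LinearMap.neg_apply, neg_inj]
    have hPUle' : P ⊓ LinearMap.ker C ≤ Up := fun v hv => (hUp v).2 (hιb v hv)
    have hQUle' : P.map C ≤ Up := fun v hv => (hUp v).2 (hιc v hv)
    have hPUmem' : ∀ v ∈ Up, Θ v = v → v ∈ P ⊓ LinearMap.ker C := fun v hv hΘv => hmemB v ((hUp v).1 hv) hΘv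
    have hPUΘ' : ∀ v ∈ P ⊓ LinearMap.ker C, Θ v = v := fun v hv => (hP v).1 (Submodule.mem_inf.1 hv).1
    have hQUmem' : ∀ v ∈ Up, Θ v = -v → v ∈ P.map C := fun v hv hΘv => hmemC v ((hUp v).1 hv) hΘv
    have hQUΘ' : ∀ v ∈ P.map C, Θ v = -v := fun v hv => (hQ v).1 (hmapCQ hv)
    have hPUQU' : ∀ v ∈ P ⊓ LinearMap.ker C, ∀ w ∈ P.map C, s v w = 0 := fun v hv w hw =>
      hPQ v (Submodule.mem_inf.1 hv).1 w (hmapCQ hw)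
    have hdefPU' : ∀ v ∈ P ⊓ LinearMap.ker C, s v v = 0 → v = 0 := fun v hv h =>
      hdefP v (Submodule.mem_inf.1 hv).1 h
    have hdefQU' : ∀ w ∈ P.map C, s w w = 0 → w = 0 := fun w hw h => hdefQ w (hmapCQ hw) h
    have hLp' : ∀ A, A ∈ Lp ↔ ∃ Z ∈ 𝔊, Z * (-ι) = (-ι) * Z ∧ ∀ v : Up, ((A v : Up) : W) = Z v := fun A => by
      rw [hLp]
      constructor
      · rintro ⟨Z, hZ, hZc, hZv⟩; exact ⟨Z, hZ, by rw [mul_neg, neg_mul, hZc], hZv⟩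
      · rintro ⟨Z, hZ, hZc, hZv⟩; exact ⟨Z, hZ, by rw [mul_neg, neg_mul, neg_inj] at hZc; exact hZc, hZv⟩
    obtain ⟨ιp, Pp, Qp, hιpapply, hPpmem, hQpmem, hbrLp, hirrLp, hιpmem, hιpιp, hPp, hQp, hfinPp, hfinQp, hPpQp, hdefPp,
      hdefQp, hadjLp, -, -⟩ :=
      UnitaryLeviFull.levi_axioms hbr hirr hΘΘ hP hQ hadd hsymm hPQ hdefP hdefQ hadj hnι hnιι hnιs hΘ hΘΘ hnιΘ hUp'
        hPUle' hQUle' hPUmem' hPUΘ' hQUmem' hQUΘ' hPUQU' hdefPU' hdefQU' hLp'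
    rw [hP₀2] at hfinPp
    rw [hfinQU] at hfinQp
    -- the restriction `y = X|_{U⁺}`: a rank-one raising element of `L⁺`
    set y : Module.End ℂ Up := X.restrict (hcp X hXc) with hydef
    have hyval : ∀ v : Up, ((y v : Up) : W) = X v := fun v => rfl
    have hymem : y ∈ Lp := (hLp y).2 ⟨X, hX, hXc, hyval⟩
    have hιpy : ιp * y = y := LinearMap.ext fun v => Subtype.ext (by
      rw [Module.End.mul_apply, hιpapply, hyval, ← Module.End.mul_apply, hΘX])
    have hyιp : y * ιp = -y := LinearMap.ext fun v => Subtype.ext (by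
      rw [Module.End.mul_apply, LinearMap.neg_apply, Submodule.coe_neg, hyval, hιpapply, ← Module.End.mul_apply, hXΘ,
        LinearMap.neg_apply, hyval])
    have hyrk : Module.finrank ℂ (LinearMap.range y) = 1 := by
      rw [hydef, UnitaryLeviRank.finrank_range_restrict, hXUp']
    have hLptop : Lp = ⊤ :=
      UnitaryRankOneRaise.eq_top_of_rankOne_raise_two hbrLp hirrLp hιpmem hιpιp hPp hQp
        (s := fun v w : Up => s (v : W) w) (hsU Up) (fun v w => hsymm v w) hPpQp hdefPp hdefQp hadjLp hymem hιpy hyιp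
        hyrk hfinPp (by rw [hfinQp]; norm_num)
    have hfullp : ∀ T : Module.End ℂ Up, ∃ Z ∈ 𝔊, Z * ι = ι * Z ∧ ∀ v : Up, ((T v : Up) : W) = Z v := fun T =>
      (hLp T).1 (by rw [hLptop]; exact Submodule.mem_top)
    -- two independent vectors in `P ∩ ker C` and the maximality polarisation: a rank-one raising operator
    obtain ⟨⟨e₁, he₁⟩, he₁0⟩ := Module.finrank_pos_iff_exists_ne_zero.1
      (show 0 < Module.finrank ℂ ↥(P ⊓ LinearMap.ker C) by omega)
    have he₁0' : e₁ ≠ 0 := fun h => he₁0 (Subtype.ext h)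
    have hex₂ : ∃ e₂ ∈ P ⊓ LinearMap.ker C, e₂ ∉ ℂ ∙ e₁ := by
      by_contra hall
      push Not at hall
      have hle : P ⊓ LinearMap.ker C ≤ ℂ ∙ e₁ := fun v hv => hall v hv
      have := (Submodule.finrank_mono hle).trans (finrank_span_singleton he₁0').le
      omega
    obtain ⟨e₂, he₂, he₂1⟩ := hex₂
    have hind : ∀ a b : ℂ, a • e₁ + b • e₂ = 0 → a = 0 ∧ b = 0 := by
      intro a b hab
      by_cases hb : b = 0
      · rw [hb, zero_smul, add_zero] at hab
        exact ⟨(smul_eq_zero.1 hab).resolve_right he₁0', hb⟩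
      · exfalso
        apply he₂1
        rw [Submodule.mem_span_singleton]
        refine ⟨-(b⁻¹ * a), ?_⟩
        have : e₂ = b⁻¹ • (b • e₂) := by rw [smul_smul, inv_mul_cancel₀ hb, one_smul]
        rw [this, eq_neg_of_add_eq_zero_right hab]
        module
    obtain ⟨B₁, hB₁, hΘB₁, hB₁Θ, hr1⟩ := UnitaryLeviFull.exists_rankOne_raise_of_maxRank hbr hΘ hΘΘ hB hΘB hBΘ hmax hιι
      hιΘ (fun w => hιa _ (LinearMap.mem_range_self B w))
      (fun v hιv' hΘv => LinearMap.mem_ker.1 (Submodule.mem_inf.1 (hmemD v hιv' hΘv)).2)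
      (fun v hΘv hBv => hιd v (Submodule.mem_inf.2 ⟨(hQ v).2 hΘv, LinearMap.mem_ker.2 hBv⟩)) hUp hfullp
      (hPUΘ' e₁ he₁) (hιb e₁ he₁) (hPUΘ' e₂ he₂) (hιb e₂ he₂) hind hΘc hιc' hc0
    exact hno1 B₁ hB₁ hΘB₁ hB₁Θ hr1

/-- **The mirror core `(21, 8)`** (apply `eq_top_of_smul` to `−Θ`). [cite: Ribet1983, Thm. 3]
[cite: Gordon1997, Thm. 6.3 (3)] -/
theorem UnitaryEightTwentyOne.eq_top_of_smul' [FiniteDimensional ℂ W] {𝔊 : Submodule ℂ (Module.End ℂ W)}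
    (hbr : ∀ Y ∈ 𝔊, ∀ Z ∈ 𝔊, Y * Z - Z * Y ∈ 𝔊)
    (hirr : ∀ U : Submodule ℂ W, (∀ A ∈ 𝔊, ∀ u ∈ U, A u ∈ U) → U = ⊥ ∨ U = ⊤)
    {Θ : Module.End ℂ W} (hΘ : Θ ∈ 𝔊) (hΘΘ : Θ * Θ = 1)
    {P Q : Submodule ℂ W} (hP : ∀ x, x ∈ P ↔ Θ x = x) (hQ : ∀ x, x ∈ Q ↔ Θ x = -x)
    (hP21 : Module.finrank ℂ P = 21) (hQ8 : Module.finrank ℂ Q = 8)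
    {s : W → W → ℂ} (hadd : ∀ x y z, s (x + y) z = s x z + s y z)
    (hsmul : ∀ (c : ℂ) (x y : W), s (c • x) y = c * s x y) (hsymm : ∀ x y, s y x = starRingEnd ℂ (s x y))
    (hPQ : ∀ p ∈ P, ∀ q ∈ Q, s p q = 0) (hdefP : ∀ p ∈ P, s p p = 0 → p = 0) (hdefQ : ∀ q ∈ Q, s q q = 0 → q = 0)
    (hadj : ∀ X ∈ 𝔊, ∃ Y ∈ 𝔊, ∀ x y, s (X x) y = s x (Y y)) : 𝔊 = ⊤ := by
  have hnΘ : -Θ ∈ 𝔊 := Submodule.neg_mem _ hΘ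
  have hnΘΘ : (-Θ) * (-Θ) = 1 := by rw [neg_mul_neg, hΘΘ]
  exact UnitaryEightTwentyOne.eq_top_of_smul hbr hirr hnΘ hnΘΘ (P := Q) (Q := P)
    (fun x => by rw [hQ, LinearMap.neg_apply, neg_eq_iff_eq_neg]) (fun x => by rw [hP, LinearMap.neg_apply, neg_inj])
    hQ8 hP21 hadd hsmul hsymm (fun p hp q hq => by rw [hsymm, hPQ q hq p hp, map_zero]) hdefQ hdefP hadj

/-! ### §3 A corollary: the `(8 | 29)` core (37-folds of type `(8, 29)`) -/

/-- **The `(8 | 29)` core.** With `(8 | 21)` in hand EVERY raising rank `ρ ∈ [1, 8]` at `(8, 29)` has a larger-side core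
`(ρ | 29 − ρ)`: `(1|28)`, `(2|27)`, `(3|26)`, `(4|25)`, `(5|24)`, `(6|23)`, `(7|22)`, `(8|21)`; so one raising operator of
rank `≥ 2` and `UnitaryDoubleLevi.eq_top_of_raise_of_core` suffice. [cite: Ribet1983, Thm. 3] [cite: Gordon1997, Thm. 6.3 (3)]
[cite: Deligne1982HodgeCycles, I §3 Prop. 3.6] -/
theorem UnitaryEight.eq_top_of_smul_twentynine [FiniteDimensional ℂ W] {𝔊 : Submodule ℂ (Module.End ℂ W)}
    (hbr : ∀ Y ∈ 𝔊, ∀ Z ∈ 𝔊, Y * Z - Z * Y ∈ 𝔊)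
    (hirr : ∀ U : Submodule ℂ W, (∀ A ∈ 𝔊, ∀ u ∈ U, A u ∈ U) → U = ⊥ ∨ U = ⊤)
    {Θ : Module.End ℂ W} (hΘ : Θ ∈ 𝔊) (hΘΘ : Θ * Θ = 1)
    {P Q : Submodule ℂ W} (hP : ∀ x, x ∈ P ↔ Θ x = x) (hQ : ∀ x, x ∈ Q ↔ Θ x = -x)
    (hP8 : Module.finrank ℂ P = 8) (hQ29 : Module.finrank ℂ Q = 29)
    {s : W → W → ℂ} (hadd : ∀ x y z, s (x + y) z = s x z + s y z)
    (hsmul : ∀ (c : ℂ) (x y : W), s (c • x) y = c * s x y) (hsymm : ∀ x y, s y x = starRingEnd ℂ (s x y))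
    (hPQ : ∀ p ∈ P, ∀ q ∈ Q, s p q = 0) (hdefP : ∀ p ∈ P, s p p = 0 → p = 0) (hdefQ : ∀ q ∈ Q, s q q = 0 → q = 0)
    (hadj : ∀ X ∈ 𝔊, ∃ Y ∈ 𝔊, ∀ x y, s (X x) y = s x (Y y)) : 𝔊 = ⊤ := by
  classical
  obtain ⟨B, hB, hΘB, hBΘ, hr2⟩ :=
    UnitaryThreeCoprime.exists_raise_rank_ge_two hbr hirr hΘ hΘΘ hP hQ (by omega) (by omega)
  have hraiseval : ∀ w, B w ∈ P := fun w => (hP _).2 (by rw [← Module.End.mul_apply, hΘB])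
  have hr8 : Module.finrank ℂ (LinearMap.range B) ≤ 8 :=
    (Submodule.finrank_mono (by rintro _ ⟨w, rfl⟩; exact hraiseval w)).trans hP8.le
  have hsU : ∀ U : Submodule ℂ W, ∀ x y z : U, s ((x + y : U) : W) z = s (x : W) z + s (y : W) z :=
    fun U x y z => by simp only [Submodule.coe_add, hadd]
  have hsmU : ∀ U : Submodule ℂ W, ∀ (c : ℂ) (x y : U), s ((c • x : U) : W) y = c * s (x : W) y :=
    fun U c x y => by simp only [Submodule.coe_smul, hsmul]
  refine UnitaryDoubleLevi.eq_top_of_raise_of_core hbr hirr hΘ hΘΘ hP hQ hadd hsymm hPQ hdefP hdefQ hadj hB hΘB hBΘ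
    (by omega) (by omega) (by omega)
    fun U 𝔩 ι P' Q' hbr𝔩 hirr𝔩 hι hιι hP' hQ' hfinP' hfinQ' hP'Q' hdefP' hdefQ' hadj𝔩 => ?_
  rw [hQ29] at hfinQ'
  obtain ⟨ρ, hρ⟩ : ∃ ρ, Module.finrank ℂ (LinearMap.range B) = ρ := ⟨_, rfl⟩
  rw [hρ] at hfinP' hfinQ' hr2 hr8
  interval_cases ρ
  · exact UnitaryTwoOdd.eq_top hbr𝔩 hirr𝔩 hι hιι hP' hQ' hfinP' ⟨13, by omega⟩ (s := fun x y : U => s (x : W) y)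
      (hsU U) (fun x y => hsymm x y) hP'Q' hdefP' hdefQ' hadj𝔩
  · exact UnitaryThreeCoprime.eq_top hbr𝔩 hirr𝔩 hι hιι hP' hQ' hfinP' (by omega) (s := fun x y : U => s (x : W) y)
      (hsU U) (fun x y => hsymm x y) hP'Q' hdefP' hdefQ' hadj𝔩
  · exact UnitaryFourOdd.eq_top hbr𝔩 hirr𝔩 hι hιι hP' hQ' hfinP' ⟨12, by omega⟩ (s := fun x y : U => s (x : W) y)
      (hsU U) (fun x y => hsymm x y) hP'Q' hdefP' hdefQ' hadj𝔩
  · exact UnitaryFive.eq_top_of_smul hbr𝔩 hirr𝔩 hι hιι hP' hQ' hfinP' (by omega) (s := fun x y : U => s (x : W) y)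
      (hsU U) (hsmU U) (fun x y => hsymm x y) hP'Q' hdefP' hdefQ' hadj𝔩
  · exact UnitarySix.eq_top_of_smul hbr𝔩 hirr𝔩 hι hιι hP' hQ' hfinP' ⟨11, by omega⟩ (by omega)
      (s := fun x y : U => s (x : W) y) (hsU U) (hsmU U) (fun x y => hsymm x y) hP'Q' hdefP' hdefQ' hadj𝔩
  · exact UnitarySeven.eq_top_of_smul hbr𝔩 hirr𝔩 hι hιι hP' hQ' hfinP' (by omega) (s := fun x y : U => s (x : W) y)
      (hsU U) (hsmU U) (fun x y => hsymm x y) hP'Q' hdefP' hdefQ' hadj𝔩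
  · exact UnitaryEightTwentyOne.eq_top_of_smul hbr𝔩 hirr𝔩 hι hιι hP' hQ' hfinP' (by omega)
      (s := fun x y : U => s (x : W) y) (hsU U) (hsmU U) (fun x y => hsymm x y) hP'Q' hdefP' hdefQ' hadj𝔩

/-- **The mirror core `(29, 8)`** (apply `eq_top_of_smul_twentynine` to `−Θ`). [cite: Ribet1983, Thm. 3]
[cite: Gordon1997, Thm. 6.3 (3)] -/
theorem UnitaryEight.eq_top_of_smul_twentynine' [FiniteDimensional ℂ W] {𝔊 : Submodule ℂ (Module.End ℂ W)}
    (hbr : ∀ Y ∈ 𝔊, ∀ Z ∈ 𝔊, Y * Z - Z * Y ∈ 𝔊)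
    (hirr : ∀ U : Submodule ℂ W, (∀ A ∈ 𝔊, ∀ u ∈ U, A u ∈ U) → U = ⊥ ∨ U = ⊤)
    {Θ : Module.End ℂ W} (hΘ : Θ ∈ 𝔊) (hΘΘ : Θ * Θ = 1)
    {P Q : Submodule ℂ W} (hP : ∀ x, x ∈ P ↔ Θ x = x) (hQ : ∀ x, x ∈ Q ↔ Θ x = -x)
    (hP29 : Module.finrank ℂ P = 29) (hQ8 : Module.finrank ℂ Q = 8)
    {s : W → W → ℂ} (hadd : ∀ x y z, s (x + y) z = s x z + s y z)
    (hsmul : ∀ (c : ℂ) (x y : W), s (c • x) y = c * s x y) (hsymm : ∀ x y, s y x = starRingEnd ℂ (s x y))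
    (hPQ : ∀ p ∈ P, ∀ q ∈ Q, s p q = 0) (hdefP : ∀ p ∈ P, s p p = 0 → p = 0) (hdefQ : ∀ q ∈ Q, s q q = 0 → q = 0)
    (hadj : ∀ X ∈ 𝔊, ∃ Y ∈ 𝔊, ∀ x y, s (X x) y = s x (Y y)) : 𝔊 = ⊤ := by
  have hnΘ : -Θ ∈ 𝔊 := Submodule.neg_mem _ hΘ
  have hnΘΘ : (-Θ) * (-Θ) = 1 := by rw [neg_mul_neg, hΘΘ]
  exact UnitaryEight.eq_top_of_smul_twentynine hbr hirr hnΘ hnΘΘ (P := Q) (Q := P)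
    (fun x => by rw [hQ, LinearMap.neg_apply, neg_eq_iff_eq_neg]) (fun x => by rw [hP, LinearMap.neg_apply, neg_inj])
    hQ8 hP29 hadd hsmul hsymm (fun p hp q hq => by rw [hsymm, hPQ q hq p hp, map_zero]) hdefQ hdefP hadj

end HodgeStructure

end Literature.AlgebraicGeometry.Motives
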